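/-
Origin: expansion seat `planner-pub-hodgecm-pv09-g4-0`, handover #6 2026-08-18T07:38:06Z (`HOME/pub-hodgecm-pv09-g4/lean/Pv09g4/RallisAdicEnd.lean`, md5 2e0b7bfa, 244 lines);
landed by the gen-7 packager in gate run 26 as `HodgeCM/PerL34/RallisAdicEnd.lean` (import ^import Pv[0-9]+g[0-9]+\.→import HodgeCM.PerL34. ×1).
-/
/-
HodgeCM / PerL34 publication cell — seam S3 (pub-hodgecm-pv09-g4, HANDOVER #6).
Imports: `Pv09g4.RallisCompactDomain` (HANDOVER #5) ↦ `HodgeCM.PerL34.RallisCompactDomain`, and the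
run-25 tree file `HodgeCM.PerL34.NonsplitRamified` (pv13-g3).
Complete proofs, no new axioms, nothing cited.
-/
import Summits.HodgeConjecture.HodgeCM.PerL34.RallisCompactDomain
import Summits.HodgeConjecture.HodgeCM.PerL34.NonsplitRamified

/-!
# Seam S3 — `𝓕, h𝓕c, h𝓕i, hN31e` from the N31e leaves and N31f alone

`PureTensor.exists_compactDomain_N31e` (HANDOVER #5) discharges the four `𝓕`-side binders of the
compact branch of the S3 end theorem, but — because gen-1 `RallisIP.N31e_holds` needs the global
half of N31f, `hint : Integrable (y ↦ ⟪φ, ω(y)φ⟫) μ`, for the unfolding — it takes the whole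
representation-side package (`hφ hloc hK hM`, the unramified place data `X`, `hclS`, `hsum`) through
pv09-g4 `integrable_coeff_haarDatum`.  Consumers that already hold `hint` (or prove it from their own
place models, as pv13-g3's adic END FORMS do internally) want the leaner form proved here:

* `exists_compactDomain_N31e_of_integrable` — hypotheses: the set-up (`U(W_i)(L₀)` discrete and
  cocompact, `hW hh jA hjA j hj χ hχΓ hχVΓ`, level + local continuity of `χ` for measurability), the
  leaves N31c `hbasic`, N31d `hPinv hEis hKE`, and `hint`; conclusion
  `∃ 𝓕, IsCompact 𝓕 ∧ (interior 𝓕).Nonempty ∧ MeasurableSet 𝓕 ∧ IsFundamentalDomain jA.range 𝓕 μ ∧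
   μ 𝓕 ≠ 0 ∧ μ 𝓕 ≠ ⊤ ∧ N31e_statement μ 𝓕 ω φ χ′ K c`.

# The END FORM of seam S3 over the completions, `𝓕`-side discharged

* `exists_compactDomain_theta_ne_zero_adic_all` — pv13-g3's END FORM
  `SplitShells.theta_ne_zero_levels_adic_all` (every per-place ANALYTIC statement proved; per place only
  identification / choice / level / dictionary / isotypy data remain) with its global binders
  `𝓕, h𝓕c, h𝓕i, hN31e` DISCHARGED: they are replaced by the two set-up facts "`U(W_i)(L₀)` discrete and
  cocompact in `U(W_i)(𝔸)`" (instances on `jA.range`) and the leaves of node N31e (N31c `hbasic`, N31d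
  `hPinv hEis hKE`, the rational set-up `hW hh jA hjA j hj χ hχΓ hχVΓ`).  The N31f integrability needed to
  unfold N31e is PROVED here from the same per-place data the END FORM consumes (the split models of
  pv13-g3/pv07-g2 assembled into pv09-g3's `UnramifiedPlaceData`, `Σ_{v∉S} N(v)^{-3/2} < ∞` from the places
  of `L₀`).  Conclusion: `∃ 𝓕, IsCompact 𝓕 ∧ (interior 𝓕).Nonempty ∧ IsFundamentalDomain jA.range 𝓕 μ ∧
  ∀ θ Θ, θ ∈ Θ → ⟪θ,θ⟫ = ∫_𝓕∫_𝓕 χ′(u) χ̄′(u′) K(u,u′) → θ ≠ 0`.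
-/

set_option autoImplicit false

noncomputable section

open MeasureTheory Set RestrictedProduct Topology
open scoped RestrictedProduct InnerProductSpace ComplexConjugate

namespace HodgeCM.PerL34.PureTensor

open HodgeCM.PerL34.AdelicFactorisation HodgeCM.PerL34.RestrictedMeasure
  HodgeCM.PerL34.NoSmallSubgroups HodgeCM.PerL34.EulerFactorisation HodgeCM.PerL34.DiscreteFD
  HodgeCM.PerL34.RallisIP

section n31eOfIntegrable

variable {ι : Type} {G : ι → Type} [∀ i, CommGroup (G i)] [∀ i, TopologicalSpace (G i)]
  [∀ i, IsTopologicalGroup (G i)] [∀ i, T2Space (G i)] [∀ i, SecondCountableTopology (G i)]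
  [∀ i, MeasurableSpace (G i)] [∀ i, BorelSpace (G i)]
  [Countable ι] [DecidableEq ι]
  (B : ∀ i, Subgroup (G i)) (hBc : ∀ i, IsCompact (B i : Set (G i)))
  (hBo : ∀ i, IsOpen (B i : Set (G i))) (S₀ : Finset ι)
  {Sp : Type} [NormedAddCommGroup Sp] [InnerProductSpace ℂ Sp]
  {L : Type*} [Field L] [StarRing L] {W : Type*} [AddCommGroup W] [Module L W]
  {H : Type*} [Group H] {h : W →ₗ⋆[L] W →ₗ[L] L} (hW : IsLine L W) (hh : Anisotropic h)
  (ιH : (Πʳ j, [G j, B j]) × (Πʳ j, [G j, B j]) →* H)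
  (ω : (Πʳ j, [G j, B j]) →* (Sp ≃ₗᵢ[ℂ] Sp))
  (χV : (Πʳ j, [G j, B j]) →* ℂ) (norm_χV : ∀ a, ‖χV a‖ = 1)
  (jA : unitary L →* Πʳ j, [G j, B j]) (hjA : Function.Injective jA)
  [DiscreteTopology (jA.range : Subgroup (Πʳ j, [G j, B j]))]
  [CompactSpace ((Πʳ j, [G j, B j]) ⧸ (jA.range : Subgroup (Πʳ j, [G j, B j])))]
  (j : isomBox h →* H) (hj : ∀ d : unitary L, j ⟨iotaSnd d, iotaSnd_mem h d⟩ = ιH (1, jA d))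
  (χ : (Πʳ j, [G j, B j]) →* Circle) (hχΓ : ∀ d : unitary L, χ (jA d) = 1)
  (hχVΓ : ∀ d : unitary L, χV (jA d) = 1)
  (φ : Sp) (fbox Eis : H → ℂ) (K : (Πʳ j, [G j, B j]) → (Πʳ j, [G j, B j]) → ℂ) (c : ℝ)
  (hbasic : ∀ h₁ h₂ : Πʳ j, [G j, B j], fbox (ιH (h₁, h₂)) = χV h₂ * inner ℂ (ω h₂ φ) (ω h₁ φ))
  (hPinv : ∀ p ∈ (stabDelta L W).subgroupOf (isomBox h), ∀ x : H, fbox (j p * x) = fbox x)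
  (hEis : ∀ u u' : Πʳ j, [G j, B j], HasSum (eisTerm h j fbox hPinv (ιH (u, u')))
    (Eis (ιH (u, u'))))
  (hKE : ∀ u u' : Πʳ j, [G j, B j], K u u' = (c : ℂ) * (χV u')⁻¹ * Eis (ιH (u, u')))
  {T' : Finset ι} (hχT' : RestrictedProduct.boxSubgroup B T' ≤ χ.ker)
  (hlocχ : ∀ i ∈ T', Continuous fun g : G i => χ (RestrictedProduct.mulSingle B i g))
  (hint : Integrable (fun y => inner ℂ φ (ω y φ)) (haarDatum B hBc hBo S₀).μ)

include hW hh norm_χV hjA hj hχΓ hχVΓ hbasic hEis hKE hχT' hlocχ hint in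
/-- **`𝓕, h𝓕c, h𝓕i, hN31e` from the set-up, the leaves of node N31e and N31f (`hint`) alone.** -/
theorem exists_compactDomain_N31e_of_integrable :
    ∃ 𝓕 : Set (Πʳ j, [G j, B j]), IsCompact 𝓕 ∧ (interior 𝓕).Nonempty ∧ MeasurableSet 𝓕 ∧
      IsFundamentalDomain jA.range 𝓕 (haarDatum B hBc hBo S₀).μ ∧
      (haarDatum B hBc hBo S₀).μ 𝓕 ≠ 0 ∧ (haarDatum B hBc hBo S₀).μ 𝓕 ≠ ⊤ ∧
      RallisIP.N31e_statement (haarDatum B hBc hBo S₀).μ 𝓕 ω φ (fun y => ((χ y : Circle) : ℂ)) K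
        (c : ℂ) := by
  haveI : Fact (∀ i, IsOpen (B i : Set (G i))) := ⟨hBo⟩
  haveI : BorelSpace (Πʳ i, [G i, B i]) := borelSpace_rp B hBo
  haveI : MeasurableMul₂ (Πʳ i, [G i, B i]) := measurableMul₂_rp B hBo
  haveI : MeasurableInv (Πʳ i, [G i, B i]) := measurableInv_rp B hBo
  haveI : Countable (jA.range : Subgroup (Πʳ j, [G j, B j])) :=
    countable_of_discrete_rp B hBo jA.range
  haveI : Countable (unitary L) := Countable.of_equiv _ (MonoidHom.ofInjective hjA).toEquiv.symm
  have hχ : Continuous χ := continuous_char B hBo χ hχT' hlocχ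
  obtain ⟨𝓕, hc, hi, hm, hfd, h0, htop⟩ :=
    exists_compactDomain_haarDatum B hBc hBo S₀ (jA.range : Subgroup (Πʳ j, [G j, B j]))
  exact ⟨𝓕, hc, hi, hm, hfd, h0, htop, RallisIP.N31e_holds hW hh (haarDatum B hBc hBo S₀).μ ιH ω χV
    norm_χV jA hjA j hj hfd (fun y => ((χ y : Circle) : ℂ))
    (isAutChar_coe χ jA.range (by rintro _ ⟨d, rfl⟩; exact hχΓ d))
    (continuous_subtype_val.comp hχ).measurable hχVΓ φ fbox Eis K (c : ℂ) hbasic hPinv hEis hKE hint⟩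

end n31eOfIntegrable

end HodgeCM.PerL34.PureTensor

/-! ## The END FORM over the completions `L_{0,v}`, `𝓕`-side discharged -/

namespace HodgeCM.PerL34.PureTensor

open HodgeCM.PerL34.SplitShells HodgeCM.PerL34.AdelicFactorisation HodgeCM.PerL34.RestrictedMeasure
open HodgeCM.PerL34.NoSmallSubgroups HodgeCM.PerL34.EulerFactorisation HodgeCM.PerL34.DiscreteFD
open HodgeCM.PerL34.LocalFactors HodgeCM.PerL34.LocalFactors.DilationModel HodgeCM.PerL34.RallisIP
open HodgeCM.PerL34.LocalModulus HodgeCM.PerL34.SplitPlaceDilation Metric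

attribute [local instance] LocalFactors.DilationModel.Adic.nontriviallyNormedField
  LocalFactors.DilationModel.Adic.properSpace

section adicAllEndDomain

variable {ι : Type} {G : ι → Type} [∀ i, CommGroup (G i)] [∀ i, TopologicalSpace (G i)]
  [∀ i, IsTopologicalGroup (G i)] [∀ i, T2Space (G i)] [∀ i, SecondCountableTopology (G i)]
  [∀ i, LocallyCompactSpace (G i)] [∀ i, MeasurableSpace (G i)] [∀ i, BorelSpace (G i)]
  [Countable ι] [DecidableEq ι]
  (B : ∀ i, Subgroup (G i)) (hBc : ∀ i, IsCompact (B i : Set (G i)))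
  (hBo : ∀ i, IsOpen (B i : Set (G i))) (S₀ : Finset ι)
  {Sp : Type} [NormedAddCommGroup Sp] [InnerProductSpace ℂ Sp]
  {E : Type*} [NormedAddCommGroup E] [InnerProductSpace ℂ E]
  -- the set-up and the leaves of node N31e (as in `PureTensor.exists_compactDomain_N31e`)
  {L : Type*} [Field L] [StarRing L] {W : Type*} [AddCommGroup W] [Module L W]
  {H : Type*} [Group H] {h : W →ₗ⋆[L] W →ₗ[L] L} (hW : IsLine L W) (hh : Anisotropic h)
  (ιH : (Πʳ j, [G j, B j]) × (Πʳ j, [G j, B j]) →* H)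
  (ω : (Πʳ j, [G j, B j]) →* (Sp ≃ₗᵢ[ℂ] Sp))
  (χV : (Πʳ j, [G j, B j]) →* ℂ) (norm_χV : ∀ a, ‖χV a‖ = 1)
  (jA : unitary L →* Πʳ j, [G j, B j]) (hjA : Function.Injective jA)
  [DiscreteTopology (jA.range : Subgroup (Πʳ j, [G j, B j]))]
  [CompactSpace ((Πʳ j, [G j, B j]) ⧸ (jA.range : Subgroup (Πʳ j, [G j, B j])))]
  (j : isomBox h →* H) (hj : ∀ d : unitary L, j ⟨iotaSnd d, iotaSnd_mem h d⟩ = ιH (1, jA d))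
  (χ : (Πʳ j, [G j, B j]) →* Circle) (hχΓ : ∀ d : unitary L, χ (jA d) = 1)
  (hχVΓ : ∀ d : unitary L, χV (jA d) = 1)
  (φ : Sp) (fbox Eis : H → ℂ) (K : (Πʳ j, [G j, B j]) → (Πʳ j, [G j, B j]) → ℂ) (c : ℝ)
  (c_pos : 0 < c)
  (hbasic : ∀ h₁ h₂ : Πʳ j, [G j, B j], fbox (ιH (h₁, h₂)) = χV h₂ * inner ℂ (ω h₂ φ) (ω h₁ φ))
  (hPinv : ∀ p ∈ (stabDelta L W).subgroupOf (isomBox h), ∀ x : H, fbox (j p * x) = fbox x)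
  (hEis : ∀ u u' : Πʳ j, [G j, B j], HasSum (eisTerm h j fbox hPinv (ιH (u, u')))
    (Eis (ιH (u, u'))))
  (hKE : ∀ u u' : Πʳ j, [G j, B j], K u u' = (c : ℂ) * (χV u')⁻¹ * Eis (ιH (u, u')))
  -- the representation side (binders of the END FORM)
  (hφ : ‖φ‖ = 1)
  (hloc : ∀ (i : ι) (v : Sp), Continuous fun g : G i => ω (RestrictedProduct.mulSingle B i g) v)
  {T' : Finset ι} (hχT' : RestrictedProduct.boxSubgroup B T' ≤ χ.ker)
  (hlocχ : ∀ i ∈ T', Continuous fun g : G i => χ (RestrictedProduct.mulSingle B i g))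
  {T : Finset ι} (hK : ∀ k ∈ RestrictedProduct.boxSubgroup B T, ω k φ = φ)
  (hM : ∀ S : Finset ι, T ⊆ S → ∀ y : (i : ↥S) → G i,
    inner ℂ φ (ω (extendOne B S y) φ) = ∏ i : ↥S, localCoeff B ω φ i (y i))
  {S : Finset ι} {IsSplit : ι → Prop}
  (hBi : ∀ i, i ∉ S → ¬IsSplit i → (B i : Set (G i)) = Set.univ)
  (hTS : T ⊆ S) (hT'S : T' ⊆ S)
  (hcpt : ∀ i ∈ S, ¬IsSplit i → CompactSpace (G i))
  (hiso : ∀ i ∈ S, ¬IsSplit i → ∀ g : G i, ω (RestrictedProduct.mulSingle B i g) φ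
    = conj (((χ (RestrictedProduct.mulSingle B i g) : Circle) : ℂ)) • φ)
  (L₀ : Type) [Field L₀] [NumberField L₀]
  (w : ι → IsDedekindDomain.HeightOneSpectrum (NumberField.RingOfIntegers L₀))
  (hw : ∀ ⦃i j : ι⦄, i ∉ S → j ∉ S → w i = w j → i = j)

include hW hh norm_χV hjA hj hχΓ hχVΓ c_pos hbasic hEis hKE hφ hloc hχT' hlocχ hK hM hBi hTS hT'S
  hcpt hiso hw

/-- **END FORM of seam S3 over the completions `L_{0,v}`, the `𝓕`-side DISCHARGED** — pv13-g3's
`theta_ne_zero_levels_adic_all` with `𝓕, h𝓕c, h𝓕i, hN31e` replaced by "`U(W_i)(L₀)` discrete and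
cocompact" + the leaves of node N31e; the compact fundamental domain with non-empty interior is PRODUCED
(pv09-g4 `CompactDomain`) and Rallis' formula on it PROVED (`N31e_haarDatum`, N31f from the place data). -/
theorem exists_compactDomain_theta_ne_zero_adic_all
    [∀ i, MeasurableSpace ((w i).adicCompletion L₀)] [∀ i, BorelSpace ((w i).adicCompletion L₀)]
    (ν : ∀ i, ((w i).adicCompletion L₀)ˣ →* Circle) (ord : ∀ i, G i →* Multiplicative ℤ) (ϖ : ∀ i, G i)
    (ϖF : ∀ i, ((w i).adicCompletion L₀)ˣ) (hϖF : ∀ i, i ∉ S → IsUniformizer (ϖF i))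
    (ord_ϖ : ∀ i, i ∉ S → IsSplit i → ord i (ϖ i) = Multiplicative.ofAdd 1)
    (ker_ord : ∀ i, i ∉ S → IsSplit i → ∀ g : G i, ord i g = 1 ↔ g ∈ B i)
    (fixed : ∀ i, i ∉ S → IsSplit i → ∀ b : G i, b ∈ B i → ω (RestrictedProduct.mulSingle B i b) φ = φ)
    (unram : ∀ i, i ∉ S → IsSplit i → ∀ b : G i, b ∈ B i → χ (RestrictedProduct.mulSingle B i b) = 1)
    (hν : ∀ i, i ∉ S → IsSplit i → ∀ u : ((w i).adicCompletion L₀)ˣ,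
      ‖(u : (w i).adicCompletion L₀)‖ = 1 → ν i u = 1)
    (coeff_eq : ∀ i, i ∉ S → IsSplit i → ∀ n : ℤ, localCoeff B ω φ i (ϖ i ^ n)
      = ⟪ballIndicator (Adic.muV L₀ (w i)) 0 1,
          dilationRep (Adic.muV L₀ (w i)) (ν i) (ϖF i ^ n) (ballIndicator (Adic.muV L₀ (w i)) 0 1)⟫_ℂ)
    (τ : ∀ i, i ∈ S → IsSplit i → (G i ≃ₜ* ((w i).adicCompletion L₀)ˣ))
    (x₀ : ∀ i, Fin 3 → (w i).adicCompletion L₀) (r cS : ι → ℝ)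
    (hr : ∀ i ∈ S, IsSplit i → r i < ‖x₀ i‖) (hr0 : ∀ i ∈ S, IsSplit i → 0 < r i)
    (hcS : ∀ i ∈ S, IsSplit i → 0 < cS i)
    (hνS : ∀ i ∈ S, IsSplit i → ∀ y : ((w i).adicCompletion L₀)ˣ,
      (y : (w i).adicCompletion L₀) ∈ U1 (x₀ i) (r i) → ν i y = 1)
    (hχS : ∀ i (hi : i ∈ S) (hs : IsSplit i), ∀ g : G i,
      ((τ i hi hs g : ((w i).adicCompletion L₀)ˣ) : (w i).adicCompletion L₀) ∈ U1 (x₀ i) (r i) →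
        χ (RestrictedProduct.mulSingle B i g) = 1)
    (coeffS : ∀ i (hi : i ∈ S) (hs : IsSplit i), ∀ g : G i, localCoeff B ω φ i g
      = (cS i : ℂ) * ⟪ballIndicator (Adic.muV L₀ (w i)) (x₀ i) (r i),
          dilationRep (Adic.muV L₀ (w i)) (ν i) (τ i hi hs g) (ballIndicator (Adic.muV L₀ (w i)) (x₀ i) (r i))⟫_ℂ) :
    ∃ 𝓕 : Set (Πʳ j, [G j, B j]), IsCompact 𝓕 ∧ (interior 𝓕).Nonempty ∧
      IsFundamentalDomain jA.range 𝓕 (haarDatum B hBc hBo S₀).μ ∧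
      ∀ (θ : E) (Θ : Set E), θ ∈ Θ →
        ⟪θ, θ⟫_ℂ = ∫ u in 𝓕, ∫ u' in 𝓕, ((χ u : Circle) : ℂ) * conj ((χ u' : Circle) : ℂ) *
          K u u' ∂(haarDatum B hBc hBo S₀).μ ∂(haarDatum B hBc hBo S₀).μ → θ ≠ 0 := by
  classical
  -- N31f, local halves on `S`: split places by the ball dictionary, non-split places by compactness
  have hclS : ∀ i ∈ S, Integrable (localCoeff B ω φ i) ((haarDatum B hBc hBo S₀).ν i) := by
    intro i hi
    by_cases hs : IsSplit i
    · exact integrable_localCoeff_of_splitDict B hBc hBo S₀ ω φ (Adic.muV L₀ (w i)) (ν i) (x₀ i) (r i) i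
        (τ i hi hs) (hr i hi hs) (hr0 i hi hs) (cS i) (hνS i hi hs) (coeffS i hi hs)
    · haveI := hcpt i hi hs
      exact integrable_localCoeff_of_compactSpace B hBc hBo S₀ ω φ i (hloc i φ)
  -- the unramified place data off `S`: split models from the dilation dictionary, `B_v = G_v` else
  have hν1 : ∀ i, i ∉ S → ¬IsSplit i → (haarDatum B hBc hBo S₀).ν i Set.univ = 1 :=
    fun i hi hs => haarDatum_ν_univ B hBc hBo S₀ i (hBi i hi hs)
  have M : ∀ i, i ∉ S → IsSplit i → SplitPlaceModel B (haarDatum B hBc hBo S₀) ω φ χ i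
      (resIndex (ϖF i)) (((χ (RestrictedProduct.mulSingle B i (ϖ i)) : Circle) : ℂ))
      (((ν i (ϖF i) : Circle) : ℂ)) := fun i hi hs =>
    splitPlaceModelOfDilation B (haarDatum B hBc hBo S₀) ω φ χ (Adic.muV L₀ (w i)) 1 (ν i) i (ord i)
      (ϖ i) (ord_ϖ i hi hs) (ker_ord i hi hs) (hBo i).measurableSet (haarDatum_ν_self B hBc hBo S₀ i)
      (fixed i hi hs) (unram i hi hs) (ϖF i) (hϖF i hi).1 (hν i hi hs) (Adic.muV_real_closedBall L₀ (w i))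
      (coeff_eq i hi hs)
  have hsum : Summable fun j : {j : ι // j ∉ S} => EulerProduct.tOf (resIndex (ϖF j.1)) :=
    EulerProduct.summable_tOf_of_places (q := fun i => resIndex (ϖF i)) L₀ (fun j => w j.1)
      (fun j j' h => Subtype.ext (hw j.2 j'.2 h))
      (fun j => Adic.resIndex_eq_absNorm L₀ (w j.1) (ϖF j.1) (hϖF j.1 j.2))
  -- the compact fundamental domain with Rallis' formula on it (N31e unfolded through N31f)
  obtain ⟨𝓕, hc, hi, -, hfd, -, -, hN31e⟩ := exists_compactDomain_N31e B hBc hBo S₀ hW hh ιH ω χV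
    norm_χV jA hjA j hj χ hχΓ hχVΓ φ fbox Eis K c hbasic hPinv hEis hKE hφ hloc hχT' hlocχ hK hM
    (unramifiedPlaceDataOfModels B (haarDatum B hBc hBo S₀) ω φ χ M hBi hν1
      (fun i hi => two_le_resIndex (hϖF i hi).1) (fun i _ => norm_chiPi B χ i (ϖ i))
      (fun i _ => norm_nuPi (ν i) (ϖF i))) hTS hclS hsum
  exact ⟨𝓕, hc, hi, hfd, fun θ Θ hθ hnorm =>
    theta_ne_zero_levels_adic_all B hBc hBo S₀ ω φ hφ hloc χ hχT' hlocχ 𝓕 hc hi K c c_pos θ Θ hθ hN31e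
      hnorm hK hM hBi hTS hT'S hcpt hiso L₀ w hw ν ord ϖ ϖF hϖF ord_ϖ ker_ord fixed unram hν coeff_eq τ x₀
      r cS hr hr0 hcS hνS hχS coeffS⟩

end adicAllEndDomain

end HodgeCM.PerL34.PureTensor

end
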